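import Summits.ValiantsHypothesis.ValiantsHypothesis.Theorems.GrenetZeonDualUnipotentThreeHalvesHeavyTopThmCGradedCount

/-!
# `GrenetZeon.DualUnipotentThreeHalves` (stmt-ValiantsHypothesis-24318), R2 heavy-top instrument — THEOREM C(7) PORT, FRAME 2:
# letters of the graded limit from the count, the lowest weight, and reducibility from a vanishing column strip

Experiment cell «val-heavytop-census» (D-0160), engine seat val-htc-eng-1 g4.  Continuation of ✓ `…ThmCGradedCount` (notation `P_h = W.map (dp h)`,
`N_h = W.map (dm h)` there).  THIS FILE provides the structural lemmas used by the assembly `…HeavyTopThmCSeven`: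

* `jpow_mem`, `unit_mem`, `lower_band_mem` — reading members of `W` off coordinate vectors: `𝟙 ∈ P_h ⇒ J^h ∈ W`, `e_i ∈ P_h ⇒ E_{i,i+h} ∈ W`,
  `(dm h B = c) ⇒ Σ_b c_b E_{b+h,b} ∈ W` (graded: `π_{±h}` of a member is a member);
* `map_eq_top_of_finrank` — `dim P_h = 7 − h ⇒ P_h = ⊤`;  `mem_of_dot_eq_zero` — zero slack at height `1`: `N_1` IS the dot-annihilator of `P_1` (stated for `Fin n`);
* `below_of_initial` — if `N_h = ⊥` for `s < h ≤ 6` then every member of the ORIGINAL space `V` has no entry below the `s`-th subdiagonal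
  (downward induction on the initial forms, ✓ `HeavyTopTorusInitial`);
* ★ `not_irreducible_of_column_strip` — if every `X ∈ V` has `X_{ab} = 0` for `b ≤ m < a` (`m < 6`) then `span(e_0,…,e_m)` is a non-trivial
  proper invariant subspace.

Honest framing: infrastructure for the instrument's kernel port of Thm C(7); nothing here proves or refutes `HeavyTopLaw`/`HeavyTopSlowLaw`, 24318, S3 or
8062; `VP ≠ VNP` is NOT proved.  No definitions.  [this seat]
-/

noncomputable section

-- single-conjunct layout: Sub = Summit, duplicated namespace component intended
set_option linter.dupNamespace false

namespace Summit.ValiantsHypothesis.ValiantsHypothesis.Theorems.GrenetZeon.HeavyTopThmCStructure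

open Matrix

/-! ## Reading members of `W` off coordinate vectors -/

/-- `𝟙 ∈ P_h ⇒ J^h ∈ W` (the explicit matrix `[b = a + h]`). -/
theorem jpow_mem (W : Submodule ℂ (Matrix (Fin 7) (Fin 7) ℂ))
    (hgr : ∀ A ∈ W, ∀ d : ℤ, (Matrix.of fun a b : Fin 7 => if (b : ℤ) - (a : ℤ) = d then A a b else 0) ∈ W) (h : ℕ)
    (dp : Matrix (Fin 7) (Fin 7) ℂ →ₗ[ℂ] (Fin (7 - h) → ℂ))
    (hdp : ∀ A (i : Fin (7 - h)) (a b : Fin 7), (a : ℕ) = i → (b : ℕ) = i + h → dp A i = A a b)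
    (hone : (fun _ => (1 : ℂ)) ∈ W.map dp) :
    (Matrix.of fun a b : Fin 7 => if (b : ℕ) = (a : ℕ) + h then (1 : ℂ) else 0) ∈ W := by
  obtain ⟨A, hA, hAe⟩ := hone
  have key : (Matrix.of fun a b : Fin 7 => if (b : ℕ) = (a : ℕ) + h then (1 : ℂ) else 0) =
      Matrix.of fun a b : Fin 7 => if (b : ℤ) - (a : ℤ) = (h : ℤ) then A a b else 0 := by
    ext a b
    simp only [Matrix.of_apply]
    by_cases hb : (b : ℕ) = (a : ℕ) + h
    · rw [if_pos hb, if_pos (by omega)]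
      have e := congr_fun hAe ⟨(a : ℕ), by omega⟩
      rw [hdp A _ a b rfl (by simpa using hb)] at e
      exact e.symm
    · rw [if_neg hb, if_neg (by omega)]
  rw [key]; exact hgr A hA h

/-- `e_i ∈ P_h ⇒ E_{i,i+h} ∈ W`. -/
theorem unit_mem (W : Submodule ℂ (Matrix (Fin 7) (Fin 7) ℂ))
    (hgr : ∀ A ∈ W, ∀ d : ℤ, (Matrix.of fun a b : Fin 7 => if (b : ℤ) - (a : ℤ) = d then A a b else 0) ∈ W) (h : ℕ)
    (dp : Matrix (Fin 7) (Fin 7) ℂ →ₗ[ℂ] (Fin (7 - h) → ℂ))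
    (hdp : ∀ A (i : Fin (7 - h)) (a b : Fin 7), (a : ℕ) = i → (b : ℕ) = i + h → dp A i = A a b)
    (i : Fin (7 - h)) (hi : Pi.single i (1 : ℂ) ∈ W.map dp) :
    (Matrix.of fun a b : Fin 7 => if (a : ℕ) = (i : ℕ) ∧ (b : ℕ) = (i : ℕ) + h then (1 : ℂ) else 0) ∈ W := by
  classical
  obtain ⟨A, hA, hAe⟩ := hi
  have key : (Matrix.of fun a b : Fin 7 => if (a : ℕ) = (i : ℕ) ∧ (b : ℕ) = (i : ℕ) + h then (1 : ℂ) else 0) =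
      Matrix.of fun a b : Fin 7 => if (b : ℤ) - (a : ℤ) = (h : ℤ) then A a b else 0 := by
    ext a b
    simp only [Matrix.of_apply]
    by_cases hb : (b : ℤ) - (a : ℤ) = (h : ℤ)
    · rw [if_pos hb]
      have e := congr_fun hAe ⟨(a : ℕ), by omega⟩
      rw [hdp A _ a b rfl (show (b : ℕ) = (a : ℕ) + h by omega), Pi.single_apply] at e
      rw [e]
      by_cases hai : (a : ℕ) = (i : ℕ)
      · rw [if_pos ⟨hai, by omega⟩, if_pos (Fin.ext hai)]
      · rw [if_neg (fun hh => hai hh.1), if_neg (fun hh => hai (by rw [Fin.ext_iff] at hh; exact hh))]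
    · rw [if_neg hb, if_neg (fun hh => hb (by omega))]
  rw [key]; exact hgr A hA h

/-- `dm h B` read as a lower band: if `B ∈ W` and `c_i = (dm h B)_i` for `i < 7 − h`, then `Σ_b c_b E_{b+h,b} ∈ W`. -/
theorem lower_band_mem (W : Submodule ℂ (Matrix (Fin 7) (Fin 7) ℂ))
    (hgr : ∀ A ∈ W, ∀ d : ℤ, (Matrix.of fun a b : Fin 7 => if (b : ℤ) - (a : ℤ) = d then A a b else 0) ∈ W) (h : ℕ)
    (dm : Matrix (Fin 7) (Fin 7) ℂ →ₗ[ℂ] (Fin (7 - h) → ℂ))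
    (hdm : ∀ A (i : Fin (7 - h)) (a b : Fin 7), (a : ℕ) = i + h → (b : ℕ) = i → dm A i = A a b)
    (B : Matrix (Fin 7) (Fin 7) ℂ) (hB : B ∈ W) (c : Fin 7 → ℂ)
    (hc : ∀ i : Fin (7 - h), c ⟨(i : ℕ), by omega⟩ = dm B i) :
    (Matrix.of fun a b : Fin 7 => if (a : ℕ) = (b : ℕ) + h then c b else 0) ∈ W := by
  have key : (Matrix.of fun a b : Fin 7 => if (a : ℕ) = (b : ℕ) + h then c b else 0) =
      Matrix.of fun a b : Fin 7 => if (b : ℤ) - (a : ℤ) = -(h : ℤ) then B a b else 0 := by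
    ext a b
    simp only [Matrix.of_apply]
    by_cases hab : (a : ℕ) = (b : ℕ) + h
    · rw [if_pos hab, if_pos (by omega)]
      have e := hc ⟨(b : ℕ), by omega⟩
      rw [hdm B _ a b (by simpa using hab) rfl] at e
      simpa using e
    · rw [if_neg hab, if_neg (by omega)]
  rw [key]; exact hgr B hB (-(h : ℤ))

/-! ## Zero slack -/

/-- `dim P_h = 7 − h ⇒ P_h = ⊤`. -/
theorem map_eq_top_of_finrank (h : ℕ) (P : Submodule ℂ (Fin (7 - h) → ℂ)) (hP : Module.finrank ℂ P = 7 - h) : P = ⊤ :=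
  Submodule.eq_top_of_finrank_eq (by rw [hP, Module.finrank_fin_fun])

/-- **Zero slack at height one.**  If `dim P_1 + dim N_1 = 6` and `N_1 ⊥ P_1`, then every dot-annihilator of `P_1` lies in `N_1`. -/
theorem mem_of_dot_eq_zero {n : ℕ} (P N : Submodule ℂ (Fin n → ℂ)) (hPN : ∀ q ∈ N, ∀ p ∈ P, q ⬝ᵥ p = 0)
    (hsum : Module.finrank ℂ P + Module.finrank ℂ N = n) (w : Fin n → ℂ) (hw : ∀ p ∈ P, w ⬝ᵥ p = 0) : w ∈ N := by
  classical
  set e := dotProductEquiv ℂ (Fin n) with he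
  set Ann : Submodule ℂ (Fin n → ℂ) := P.dualAnnihilator.comap (e : (Fin n → ℂ) →ₗ[ℂ] Module.Dual ℂ (Fin n → ℂ))
    with hAnn
  have memAnn : ∀ v, v ∈ Ann ↔ ∀ p ∈ P, v ⬝ᵥ p = 0 := by
    intro v
    rw [hAnn, Submodule.mem_comap, Submodule.mem_dualAnnihilator]
    constructor
    · intro hv p hp
      have h1 := hv p hp
      have h2 : (e : (Fin n → ℂ) →ₗ[ℂ] Module.Dual ℂ (Fin n → ℂ)) v p = v ⬝ᵥ p := by rw [he]; rfl
      rwa [h2] at h1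
    · intro hv p hp; show e v p = 0; rw [he, dotProductEquiv_apply_apply]; exact hv p hp
  have hNle : N ≤ Ann := fun q hq => (memAnn q).2 (hPN q hq)
  have hfin : Module.finrank ℂ Ann = n - Module.finrank ℂ P := by
    have h1 : Module.finrank ℂ Ann = Module.finrank ℂ P.dualAnnihilator := by
      rw [hAnn, Submodule.comap_equiv_eq_map_symm]
      exact LinearEquiv.finrank_map_eq e.symm _
    have h2 := Subspace.finrank_add_finrank_dualAnnihilator_eq P
    rw [Module.finrank_fin_fun] at h2
    omega
  have hle := Submodule.finrank_mono hNle
  have heq : N = Ann := Submodule.eq_of_le_of_finrank_eq hNle (by omega)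
  rw [heq]; exact (memAnn w).2 hw

/-! ## The lowest weight controls the original space -/

/-- **Entries below the lowest weight vanish on `V`.**  If the initial forms of members of `V` lie in `W` and `N_h = ⊥` for `s < h ≤ 6`, then
every `Z ∈ V` has `Z_{ab} = 0` whenever `a > b + s`. -/
theorem below_of_initial (V W : Submodule ℂ (Matrix (Fin 7) (Fin 7) ℂ))
    (hinit : ∀ Z ∈ V, ∀ d : ℤ, (∀ a b : Fin 7, (b : ℤ) - (a : ℤ) < d → Z a b = 0) →
      (Matrix.of fun a b : Fin 7 => if (b : ℤ) - (a : ℤ) = d then Z a b else 0) ∈ W)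
    (dm : ∀ h : ℕ, Matrix (Fin 7) (Fin 7) ℂ →ₗ[ℂ] (Fin (7 - h) → ℂ))
    (hdm : ∀ h A (i : Fin (7 - h)) (a b : Fin 7), (a : ℕ) = i + h → (b : ℕ) = i → dm h A i = A a b)
    (s : ℕ) (hN : ∀ h : ℕ, s < h → h ≤ 6 → W.map (dm h) = ⊥) :
    ∀ Z ∈ V, ∀ a b : Fin 7, (b : ℕ) + s < (a : ℕ) → Z a b = 0 := by
  -- `claim n`: entries with `a − b ≥ 7 − n` vanish, for `n ≤ 6 − s`
  have claim : ∀ n : ℕ, n + s ≤ 6 → ∀ Z ∈ V, ∀ a b : Fin 7, (b : ℕ) + (7 - n) ≤ (a : ℕ) → Z a b = 0 := by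
    intro n
    induction n with
    | zero => intro _ Z _ a b hab; have := a.isLt; omega
    | succ n ih =>
      intro hn Z hZ a b hab
      by_cases hlt : (b : ℕ) + (7 - n) ≤ (a : ℕ)
      · exact ih (by omega) Z hZ a b hlt
      · -- the new diagonal `a - b = 6 - n =: h`, with `s < h ≤ 6`
        have hab' : (a : ℕ) = (b : ℕ) + (6 - n) := by omega
        have hmem := hinit Z hZ (-((6 - n : ℕ) : ℤ)) (fun a' b' hlt' => ih (by omega) Z hZ a' b' (by omega))
        have hq : dm (6 - n) (Matrix.of fun a b : Fin 7 => if (b : ℤ) - (a : ℤ) = -((6 - n : ℕ) : ℤ) then Z a b else 0) = 0 := by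
          have hb := hN (6 - n) (by omega) (by omega)
          rw [Submodule.eq_bot_iff] at hb
          exact hb _ ⟨_, hmem, rfl⟩
        have e := congr_fun hq ⟨(b : ℕ), by omega⟩
        rw [hdm (6 - n) _ _ a b (show (a : ℕ) = (b : ℕ) + (6 - n) by omega) rfl, Matrix.of_apply, if_pos (by omega), Pi.zero_apply] at e
        exact e
  intro Z hZ a b hab
  exact claim (6 - s) (by omega) Z hZ a b (by have := a.isLt; omega)

/-! ## Reducibility from a vanishing column strip -/

/-- ★ **A vanishing column strip gives an invariant flag piece.**  If every `X ∈ V` has `X_{ab} = 0` for `b ≤ m < a` (`m < 6`), then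
`span(e_0, …, e_m)` is a non-zero proper subspace invariant under `V`; so `V` is not irreducible. -/
theorem not_irreducible_of_column_strip (V : Submodule ℂ (Matrix (Fin 7) (Fin 7) ℂ)) (m : ℕ) (hm : m < 6)
    (hcol : ∀ X ∈ V, ∀ a b : Fin 7, (b : ℕ) ≤ m → m < (a : ℕ) → X a b = 0) :
    ¬ ∀ U : Submodule ℂ (Fin 7 → ℂ), (∀ A ∈ V, ∀ x ∈ U, A *ᵥ x ∈ U) → U = ⊥ ∨ U = ⊤ := by
  classical
  intro hirr
  set U : Submodule ℂ (Fin 7 → ℂ) := Submodule.span ℂ (Set.range fun k : Fin (m + 1) => Pi.single (⟨(k : ℕ), by omega⟩ : Fin 7) (1 : ℂ))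
    with hU
  -- members of `U` vanish beyond `m`
  have hUvan : ∀ x ∈ U, ∀ a : Fin 7, m < (a : ℕ) → x a = 0 := by
    intro x hx a ha
    induction hx using Submodule.span_induction with
    | mem y hy =>
      obtain ⟨k, rfl⟩ := hy
      dsimp only
      rw [Pi.single_apply, if_neg]
      intro hak; rw [Fin.ext_iff] at hak; simp at hak; omega
    | zero => rfl
    | add y z _ _ hy hz => rw [Pi.add_apply, hy, hz, add_zero]
    | smul t y _ hy => rw [Pi.smul_apply, hy, smul_zero]
  -- vectors vanishing beyond `m` lie in `U`
  have hUmem : ∀ x : Fin 7 → ℂ, (∀ a : Fin 7, m < (a : ℕ) → x a = 0) → x ∈ U := by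
    intro x hx
    have hxe : x = ∑ k : Fin (m + 1), x ⟨(k : ℕ), by omega⟩ • Pi.single (⟨(k : ℕ), by omega⟩ : Fin 7) (1 : ℂ) := by
      funext a
      rw [Finset.sum_apply]
      simp only [Pi.smul_apply, Pi.single_apply, smul_eq_mul, mul_ite, mul_one, mul_zero]
      by_cases ha : m < (a : ℕ)
      · rw [hx a ha]; symm
        refine Finset.sum_eq_zero fun k _ => ?_
        rw [if_neg]; intro hak; rw [Fin.ext_iff] at hak; simp at hak; omega
      · rw [Finset.sum_eq_single ⟨(a : ℕ), by omega⟩]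
        · rw [if_pos (Fin.ext rfl)]
        · intro k _ hk; rw [if_neg]; intro hak; apply hk; rw [Fin.ext_iff] at hak ⊢; simp at hak ⊢; omega
        · intro hh; exact absurd (Finset.mem_univ _) hh
    rw [hxe]
    exact U.sum_mem fun k _ => U.smul_mem _ (Submodule.subset_span ⟨k, rfl⟩)
  have hUinv : ∀ A ∈ V, ∀ x ∈ U, A *ᵥ x ∈ U := by
    intro A hA x hx
    apply hUmem
    intro a ha
    rw [Matrix.mulVec, dotProduct]
    refine Finset.sum_eq_zero fun b _ => ?_
    by_cases hb : (b : ℕ) ≤ m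
    · rw [hcol A hA a b hb ha, zero_mul]
    · rw [hUvan x hx b (by omega), mul_zero]
  rcases hirr U hUinv with h0 | h1
  · have hmem : Pi.single (⟨0, by omega⟩ : Fin 7) (1 : ℂ) ∈ U := Submodule.subset_span ⟨⟨0, by omega⟩, rfl⟩
    rw [h0, Submodule.mem_bot] at hmem
    have := congr_fun hmem ⟨0, by omega⟩
    simp at this
  · have hmem : Pi.single (⟨6, by omega⟩ : Fin 7) (1 : ℂ) ∈ U := by rw [h1]; exact Submodule.mem_top
    have := hUvan _ hmem ⟨6, by omega⟩ (by simp; omega)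
    simp at this

end Summit.ValiantsHypothesis.ValiantsHypothesis.Theorems.GrenetZeon.HeavyTopThmCStructure

end
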